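import Summits.QuantumFields.YangMills.Theorems.PoincareLipschitzKnitLadderLetters
import HarnessLib

/-!
# Crux `HistoryTailL` (stmt-QuantumFields-19936), K2 face v2 `hRegH` (route crux `PoincareLipschitz.BlockLipschitzL`, stmt-QuantumFields-23533) —
# THE FINAL KNIT `hRegH ⟸ hImprove ∧ [C]`, FILE K-2r «FLAT END-GAME, PURE-REAL ROWS»: the four real inequalities of the end-game K-2b — the row regime from
# the WINDOW of `hImprove` v1, the top of the ladder below the `(1+log)⁶` threshold, the door's bracket, and the last line `bond² ≤ Λ(R⁻¹ + τ₀)`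

Cell `ym3-torus` (YM ladder rung R3 = continuum SU(2) Yang–Mills on T³ — a RUNG, NOT the Clay problem); LEAD seat `ym-ust-19936-w1` g9 (RULINGS g9-2∕g9-3:
«the bond is read at unit radius», «exponent 6 + window»).  Helper `--supports stmt-QuantumFields-19936`; THEOREMS ONLY (0 `def`, 0 `sorry`, default
heartbeats), pure real analysis over px8 g5 ✓`PoincareLipschitzKnitLadderLetters.one_add_log_two_mul_pow_six_le`.  Nothing here proves `hImprove`, [C],
`hRegH`, `BlockLipschitzL`, `HistoryTailL` or a summit statement.

WHAT IS PROVED (ns `…Theorems.PoincareLipschitzKnitFlatEndgame`; letters: `r` the good scale, `M = m^K` the ladder top, `κ` the window constant, `cT` the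
row-regime constant of ✓`doorRows_log6`, `Etop = E(Q_{2r}(z))`, `Ns` the Morrey class of the slack).
* `regime_of_window`: `τ₀r·log⁶r ≤ κ⁻¹`, `M ≤ 2r`, `r ≥ 8`, `128∕cT ≤ κ` ⟹ `τ₀M(1+log M)⁶ ≤ cT`.
* `top_below_threshold`: `ε₀ = ε₁∕(256m)`, `E_τ ≤ ε₀r∕log⁶r`, `Etop ≤ 2E_τ + 2250τ₀²r³`, `τ₀²r²log⁶r ≤ κ⁻¹`, `288000m∕ε₁ ≤ κ`, `r∕m ≤ M ≤ 2r` ⟹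
  `Etop ≤ ε₁r∕(64m·log⁶r) ≤ ε₁M∕(1+log M)⁶`.
* `bracket_le`: `Etop ≤ ε₁r∕(64m·log⁶r)`, `R ≤ C₀log⁶R·r`, `log⁶R ≤ 64log⁶r`, `r∕m ≤ M ≤ 2r`, `τ₀r ≤ 1`, `Ns = 324(τ₀√ε₁ + τ₀²M)` ⟹
  `(m²Etop∕M² + 2m⁴Ns)·3 ≤ 3(m³ε₁C₀∕R + 648m⁴(√ε₁+2)τ₀)`.
* `bond_sq_final`: `flat² ≤ CD·3(P∕R + Qτ₀)`, `bond ≤ flat + τ₀`, `τ₀ ≤ 1` ⟹ `bond² ≤ (2·CD·3·(P+Q) + 2)(R⁻¹ + τ₀)`.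
HONEST SCOPE.  Arithmetic only.  YM₃ on T³ is rung R3, not Clay; YM gap NOT proved.

References: M. Giaquinta, Annals of Math. Studies 105 (1983) [Giaquinta1984] (Ch. III Lemma 2.1 p.86: iteration with a source and a threshold).
-/

set_option autoImplicit false

noncomputable section

namespace Summit.QuantumFields.YangMills.Theorems.PoincareLipschitzKnitFlatEndgame

open Summit.QuantumFields.YangMills.Theorems.PoincareLipschitzKnitLadderLetters (one_add_log_two_mul_pow_six_le)

/-! ## §1 Pure-real rows of the end-game -/

/-- **THE ROW REGIME FROM THE WINDOW**: `τ₀·M·(1+log M)⁶ ≤ cT` once `M ≤ 2r`, `r ≥ 8`, `τ₀r·log⁶r ≤ κ⁻¹` and `128∕cT ≤ κ`. [folklore] -/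
theorem regime_of_window {τ₀ r M κ cT : ℝ} (hτ0 : 0 ≤ τ₀) (hr8 : 8 ≤ r) (hM1 : 1 ≤ M) (hM2r : M ≤ 2 * r)
    (hkey : τ₀ * r * Real.log r ^ 6 ≤ κ⁻¹) (hκ0 : 0 < κ) (hcT : 0 < cT) (hκa : 128 / cT ≤ κ) :
    τ₀ * M * (1 + Real.log M) ^ 6 ≤ cT := by
  have hr0 : 0 < r := by linarith
  have hlogM : 1 + Real.log M ≤ 1 + Real.log (2 * r) := by have := Real.log_le_log (by linarith) hM2r; linarith
  have hlogM0 : 0 ≤ 1 + Real.log M := by have := Real.log_nonneg hM1; linarith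
  have h1 : (1 + Real.log M) ^ 6 ≤ 64 * Real.log r ^ 6 := (pow_le_pow_left₀ hlogM0 hlogM 6).trans (one_add_log_two_mul_pow_six_le hr8)
  have h2 : τ₀ * M * (1 + Real.log M) ^ 6 ≤ τ₀ * (2 * r) * (64 * Real.log r ^ 6) :=
    mul_le_mul (mul_le_mul_of_nonneg_left hM2r hτ0) h1 (by positivity) (by positivity)
  have h4 : 128 * κ⁻¹ ≤ cT := by
    rw [div_le_iff₀ hcT] at hκa
    rw [← div_eq_mul_inv, div_le_iff₀ hκ0]; linarith
  calc τ₀ * M * (1 + Real.log M) ^ 6 ≤ τ₀ * (2 * r) * (64 * Real.log r ^ 6) := h2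
    _ = 128 * (τ₀ * r * Real.log r ^ 6) := by ring
    _ ≤ 128 * κ⁻¹ := by linarith
    _ ≤ cT := h4

/-- **THE TOP OF THE LADDER IS BELOW THRESHOLD**: with `ε₀ = ε₁∕(256m)`, the organ's `E_τ ≤ ε₀r∕log⁶r`, the letters' `Etop ≤ 2E_τ + 2250τ₀²r³`, the window's
`τ₀²r²log⁶r ≤ κ⁻¹` and `288000m∕ε₁ ≤ κ`: `Etop ≤ ε₁r∕(64m·log⁶r) ≤ ε₁M∕(1+log M)⁶` for the ladder top `r∕m ≤ M ≤ 2r`. [folklore] -/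
theorem top_below_threshold {ε₁ ε₀ τ₀ r m M κ Eτ Etop : ℝ} (hε₁ : 0 < ε₁) (hm : 2 ≤ m) (hr8 : 8 ≤ r) (hε₀ : ε₀ = ε₁ / (256 * m))
    (hEτ : Eτ ≤ ε₀ * r / Real.log r ^ 6) (hEtop : Etop ≤ 2 * Eτ + 2250 * τ₀ ^ 2 * r ^ 3)
    (hkey2 : τ₀ ^ 2 * r ^ 2 * Real.log r ^ 6 ≤ κ⁻¹) (hκ0 : 0 < κ) (hκb : 288000 * m / ε₁ ≤ κ)
    (hrM : r / m ≤ M) (hM2r : M ≤ 2 * r) (hM1 : 1 ≤ M) :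
    Etop ≤ ε₁ * r / (64 * m * Real.log r ^ 6) ∧ ε₁ * r / (64 * m * Real.log r ^ 6) ≤ ε₁ * M / (1 + Real.log M) ^ 6 := by
  have hr0 : 0 < r := by linarith
  have hm0 : 0 < m := by linarith
  have hlogr1 : 1 ≤ Real.log r := by
    rw [Real.le_log_iff_exp_le hr0]; have := Real.exp_one_lt_d9; linarith
  have hlogr0 : 0 < Real.log r := by linarith
  have hL6 : 0 < Real.log r ^ 6 := by positivity
  constructor
  · have hε₀r : 2 * (ε₀ * r / Real.log r ^ 6) = ε₁ * r / (128 * m * Real.log r ^ 6) := by rw [hε₀]; field_simp; ring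
    have h1 : 288000 * m * κ⁻¹ ≤ ε₁ := by
      rw [div_le_iff₀ hε₁] at hκb
      rw [← div_eq_mul_inv, div_le_iff₀ hκ0]; linarith
    have hjunk : 2250 * τ₀ ^ 2 * r ^ 3 ≤ ε₁ * r / (128 * m * Real.log r ^ 6) := by
      rw [le_div_iff₀ (by positivity)]
      calc 2250 * τ₀ ^ 2 * r ^ 3 * (128 * m * Real.log r ^ 6) = 288000 * m * (τ₀ ^ 2 * r ^ 2 * Real.log r ^ 6) * r := by ring
        _ ≤ 288000 * m * κ⁻¹ * r := mul_le_mul_of_nonneg_right (mul_le_mul_of_nonneg_left hkey2 (by positivity)) hr0.le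
        _ ≤ ε₁ * r := mul_le_mul_of_nonneg_right h1 hr0.le
    have e : ε₁ * r / (64 * m * Real.log r ^ 6) = 2 * (ε₁ * r / (128 * m * Real.log r ^ 6)) := by field_simp; ring
    have h2 : 2 * Eτ ≤ 2 * (ε₀ * r / Real.log r ^ 6) := by linarith
    rw [e]; linarith
  · have hlogM : 1 + Real.log M ≤ 1 + Real.log (2 * r) := by have := Real.log_le_log (by linarith) hM2r; linarith
    have hlogM0 : 1 ≤ 1 + Real.log M := by have := Real.log_nonneg hM1; linarith
    have hden : (1 + Real.log M) ^ 6 ≤ 64 * Real.log r ^ 6 :=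
      (pow_le_pow_left₀ (by linarith) hlogM 6).trans (one_add_log_two_mul_pow_six_le hr8)
    have hden0 : 0 < (1 + Real.log M) ^ 6 := by positivity
    rw [div_le_div_iff₀ (by positivity) hden0]
    have hrMm : r ≤ M * m := by rw [div_le_iff₀ hm0] at hrM; linarith
    calc ε₁ * r * (1 + Real.log M) ^ 6 ≤ ε₁ * r * (64 * Real.log r ^ 6) := mul_le_mul_of_nonneg_left hden (by positivity)
      _ ≤ ε₁ * (M * m) * (64 * Real.log r ^ 6) := by
          refine mul_le_mul_of_nonneg_right (mul_le_mul_of_nonneg_left hrMm hε₁.le) (by positivity)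
      _ = ε₁ * M * (64 * m * Real.log r ^ 6) := by ring

/-- **THE DOOR'S BRACKET**: `(m²Etop∕M² + 2m⁴Ns)·3 ≤ 3·(m³ε₁C₀∕R + 648m⁴(√ε₁+2)·τ₀)` from `Etop ≤ ε₁r∕(64m·log⁶r)`, the scale loss `R ≤ C₀log⁶R·r`,
`log⁶R ≤ 64log⁶r`, the ladder `r∕m ≤ M ≤ 2r`, `τ₀r ≤ 1`, and `Ns = 324(τ₀√ε₁ + τ₀²M)`. [folklore] -/
theorem bracket_le {ε₁ τ₀ r m M R C₀ Etop Ns : ℝ} (hε₁ : 0 < ε₁) (hm : 2 ≤ m) (hr8 : 8 ≤ r) (hτ0 : 0 ≤ τ₀) (hR : 0 < R) (hC₀ : 1 ≤ C₀)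
    (hEtop0 : 0 ≤ Etop) (hEtop : Etop ≤ ε₁ * r / (64 * m * Real.log r ^ 6)) (hloss : R ≤ C₀ * Real.log R ^ 6 * r)
    (hlog6 : Real.log R ^ 6 ≤ 64 * Real.log r ^ 6) (hrM : r / m ≤ M) (hM2r : M ≤ 2 * r) (hτr1 : τ₀ * r ≤ 1)
    (hNs : Ns = 324 * (τ₀ * Real.sqrt ε₁ + τ₀ ^ 2 * M)) :
    (m ^ 2 * Etop / M ^ 2 + 2 * (m ^ 2) ^ 2 * Ns) * (2 * (((1 : ℕ) : ℝ)) + 1) ≤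
      3 * (m ^ 3 * ε₁ * C₀ / R + 648 * m ^ 4 * (Real.sqrt ε₁ + 2) * τ₀) := by
  have hr0 : 0 < r := by linarith
  have hm0 : 0 < m := by linarith
  have hlogr1 : 1 ≤ Real.log r := by
    rw [Real.le_log_iff_exp_le hr0]; have := Real.exp_one_lt_d9; linarith
  have hlogr0 : 0 < Real.log r := by linarith
  have hM0 : 0 < M := lt_of_lt_of_le (by positivity) hrM
  -- `Etop ∕ M² ≤ ε₁ m C₀ ∕ R`
  have hMsq : r ^ 2 / m ^ 2 ≤ M ^ 2 := by
    have := pow_le_pow_left₀ (by positivity : 0 ≤ r / m) hrM 2; rwa [div_pow] at this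
  have h1 : Etop / M ^ 2 ≤ Etop * m ^ 2 / r ^ 2 := by
    calc Etop / M ^ 2 ≤ Etop / (r ^ 2 / m ^ 2) := div_le_div_of_nonneg_left hEtop0 (by positivity) hMsq
      _ = Etop * m ^ 2 / r ^ 2 := by field_simp
  have h2 : Etop * m ^ 2 / r ^ 2 ≤ ε₁ * m / (64 * (r * Real.log r ^ 6)) := by
    calc Etop * m ^ 2 / r ^ 2 ≤ ε₁ * r / (64 * m * Real.log r ^ 6) * m ^ 2 / r ^ 2 :=
          div_le_div_of_nonneg_right (mul_le_mul_of_nonneg_right hEtop (by positivity)) (by positivity)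
      _ = ε₁ * m / (64 * (r * Real.log r ^ 6)) := by field_simp
  have h5 : R ≤ 64 * C₀ * (r * Real.log r ^ 6) := by
    calc R ≤ C₀ * Real.log R ^ 6 * r := hloss
      _ ≤ C₀ * (64 * Real.log r ^ 6) * r := mul_le_mul_of_nonneg_right (mul_le_mul_of_nonneg_left hlog6 (by linarith)) hr0.le
      _ = 64 * C₀ * (r * Real.log r ^ 6) := by ring
  have h6 : ε₁ * m / (64 * (r * Real.log r ^ 6)) ≤ ε₁ * m * C₀ / R := by
    rw [div_le_div_iff₀ (by positivity) hR]
    have := mul_le_mul_of_nonneg_left h5 (show 0 ≤ ε₁ * m by positivity)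
    linarith
  have hE : m ^ 2 * Etop / M ^ 2 ≤ m ^ 3 * ε₁ * C₀ / R := by
    rw [mul_div_assoc]
    calc m ^ 2 * (Etop / M ^ 2) ≤ m ^ 2 * (ε₁ * m * C₀ / R) := mul_le_mul_of_nonneg_left (h1.trans (h2.trans h6)) (by positivity)
      _ = m ^ 3 * ε₁ * C₀ / R := by ring
  -- `Ns ≤ 324(√ε₁ + 2)τ₀`
  have hN : Ns ≤ 324 * (Real.sqrt ε₁ + 2) * τ₀ := by
    rw [hNs]
    have : τ₀ ^ 2 * M ≤ 2 * τ₀ := by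
      calc τ₀ ^ 2 * M ≤ τ₀ ^ 2 * (2 * r) := mul_le_mul_of_nonneg_left hM2r (sq_nonneg _)
        _ = 2 * τ₀ * (τ₀ * r) := by ring
        _ ≤ 2 * τ₀ * 1 := mul_le_mul_of_nonneg_left hτr1 (by positivity)
        _ = 2 * τ₀ := by ring
    nlinarith [Real.sqrt_nonneg ε₁]
  have hN2 : 2 * (m ^ 2) ^ 2 * Ns ≤ 648 * m ^ 4 * (Real.sqrt ε₁ + 2) * τ₀ := by
    calc 2 * (m ^ 2) ^ 2 * Ns ≤ 2 * (m ^ 2) ^ 2 * (324 * (Real.sqrt ε₁ + 2) * τ₀) := mul_le_mul_of_nonneg_left hN (by positivity)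
      _ = 648 * m ^ 4 * (Real.sqrt ε₁ + 2) * τ₀ := by ring
  push_cast
  linarith

/-- **THE LAST LINE**: `flat² ≤ CD·3(P∕R + Qτ₀)` and `bond ≤ flat + τ₀` (`τ₀ ≤ 1`) ⟹ `bond² ≤ (2·CD·3·(P+Q) + 2)·(R⁻¹ + τ₀)`. [folklore] -/
theorem bond_sq_final {flat bond τ₀ R CD P Q : ℝ} (hflat0 : 0 ≤ flat) (hτ0 : 0 ≤ τ₀) (hτ1 : τ₀ ≤ 1) (hR : 0 < R) (hCD : 0 ≤ CD)
    (hP : 0 ≤ P) (hQ : 0 ≤ Q) (hflat : flat ^ 2 ≤ CD * (3 * (P / R + Q * τ₀))) (hbond : bond ≤ flat + τ₀) (hbond0 : 0 ≤ bond) :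
    bond ^ 2 ≤ (2 * CD * 3 * (P + Q) + 2) * (R⁻¹ + τ₀) := by
  have hRi : 0 < R⁻¹ := inv_pos.mpr hR
  have h1 : bond ^ 2 ≤ 2 * flat ^ 2 + 2 * τ₀ ^ 2 := by nlinarith [sq_nonneg (flat - τ₀)]
  have hPR : P / R ≤ (P + Q) * (R⁻¹ + τ₀) := by
    rw [div_eq_mul_inv]; nlinarith [mul_nonneg hQ hRi.le, mul_nonneg hP hτ0, mul_nonneg hQ hτ0]
  have hQτ : Q * τ₀ ≤ (P + Q) * (R⁻¹ + τ₀) := by nlinarith [mul_nonneg hQ hRi.le, mul_nonneg hP hτ0, mul_nonneg hP hRi.le]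
  have hτsq : τ₀ ^ 2 ≤ R⁻¹ + τ₀ := by nlinarith
  have hsum : P / R + Q * τ₀ ≤ (P + Q) * (R⁻¹ + τ₀) := by
    rw [div_eq_mul_inv]; nlinarith [mul_nonneg hP hτ0, mul_nonneg hQ hRi.le]
  have h3 : CD * (3 * (P / R + Q * τ₀)) ≤ CD * 3 * ((P + Q) * (R⁻¹ + τ₀)) := by
    have := mul_le_mul_of_nonneg_left hsum (show 0 ≤ CD * 3 by positivity)
    linarith
  have h4 : 0 ≤ CD * 3 * ((P + Q) * (R⁻¹ + τ₀)) := by positivity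
  nlinarith

end Summit.QuantumFields.YangMills.Theorems.PoincareLipschitzKnitFlatEndgame

end
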